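import Summits.BirchSwinnertonDyer.Rank1Residual.Supersingular.KuriharaTwistBirchChar
import Summits.BirchSwinnertonDyer.Rank1Residual.Supersingular.KuriharaTwistSymbolKurihara
import Literature.NumberTheory.EllipticCurves.PAdicLFunctionNeZeroHoldsProofs
import Literature.NumberTheory.EllipticCurves.LeadingTermPPartProofs
import HarnessLib

/-!
# The character bins of the plus symbol of the newform of `E` ARE the finite Fourier transform of
# `L(E,1)` and the twisted central values `L(f, χ̄_j, 1)` (Birch's formula) — implementation 3's
# formula (i) of X6-KURIHARA.md §8.2 as a tree theorem (KERNEL)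

Cell `b2b-bsdres`, supersingular family, prover A = unit `b2b-bsdres-x10b` (gen 12).  Topic file; namespace
`Summit.BirchSwinnertonDyer.Rank1Residual.Supersingular.KuriharaTwist`.  THEOREMS ONLY; no named fact, no
definition, nothing asserted about any curve, nothing booked; X6 / X7 / X8 stay CONSTRUCTION-SHAPED.

HONEST FRAMING (run/shared/lean/b2b/bsd-rank1-residual/, verbatim in every file): the goal of the
cell is to DELETE the COMBINATION-SHAPED residual classes of the Birch–Swinnerton-Dyer formula for
ALL analytic-rank `≤ 1` elliptic curves over `ℚ` — "full BSD formula for every rank `≤ 1` curve in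
class `C`" assembled STRICTLY from published theorems — so that the rank-`≤ 1` remainder becomes
exactly the CONSTRUCTION-SHAPED classes, which are TYPED (missing-input `Prop`s), NOT attempted.
This is not "finishing BSD".

## What this file proves (`f` the newform of `E = W`, `IsNewformOf W f`; `n` square-free, all `ℓ ∣ n` good)

* `sum_mulChar_mul_eq_sum_units`, `filter_val_eq_filter_binLogHom` (the records' spelling `(Σ_ℓ ψ_ℓ(a)).val = k`
  of the bin condition `m(a) = k`, `k < M`) — bookkeeping.
* `sum_units_ratPlusSymbol_eq_prod_mul` — **`S_0`**: `Σ_{a ∈ (ℤ/n)ˣ} [a/n]⁺_f = Π_{ℓ∣n} (a_ℓ(E) − 2)·[0]⁺_f`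
  (Part A of the sibling on `P = [·]⁺_f`, Hecke relation `hecke_ratPlusSymbol_of_isNewformOf`), and
  `sum_units_ratPlusSymbol_mul_plusPeriod`: `S_0·Ω⁺_f = Π_ℓ (a_ℓ − 2)·L(E,1)` (`W.entireLFunction 1`,
  `IsNewformOf.entireLFunction_one_eq`).
* `sum_units_binChar_mul_ratPlusSymbol_mul_plusPeriod` — **`S_j`, `j ≠ 0`**:
  `(Σ_a χ_j(a)[a/n]⁺_f)·Ω⁺_f = τ(χ_j)·L_j(1)` for ANY entire continuation `L_j` of `L(f, χ_j⁻¹, s)` — BIRCH'S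
  FORMULA, the tree theorem `ratTwistedSymbolSum_mul_plusPeriod_holds` (Mazur–Tate–Teitelbaum (8.6)), fed
  with `binChar_isPrimitive` / `binChar_even` (`M` odd, `ψ_ℓ` surjective).
* **`plusPeriod_mul_binSum_eq`** — for every `k₀ ∈ ℤ/M`:
  `M·Ω⁺_f·Σ_{a : m(a) = k₀} [a/n]⁺_f = Π_{ℓ∣n}(a_ℓ − 2)·L(E,1) + Σ_{j ≠ 0} e_M(−j k₀)·τ(χ_j)·L_j(1)`;
  real form `ratCast_binSum_eq_re_div`: `Σ_{m(a)=k₀}[a/n]⁺_f = re(that)/(M·Ω⁺_f)`.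

So the ONE non-kernel input of the Kurihara twist-record chain (`hball`: "the engine's ball contains
`D'·c_∞·Σ_{m(a)=k}[a/n]⁺_f`") is, by a tree identity, a statement about the real number
`D'·c_∞·re(Π(a_ℓ−2)L(E,1) + Σ_{j≠0} e(−jk)τ(χ_j)L(f,χ̄_j,1))/(p·Ω⁺_f)` — exactly the quantity implementation
3c/3d evaluates in ball arithmetic (twisted central values by their `q`-series at the symmetric point, Gauss
sums, roots of unity, `ω₁` by AGM with the period identification `Ω⁺_f = c_∞·ω₁`); the consumers with `hball`
so restated are `KuriharaTwistRecordAssemblyLValues.lean`.  Per pair; NOT a class theorem; nothing booked.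

References: sibling `KuriharaTwistBirchChar.lean`; `KuriharaTwistSymbolKurihara.lean` (gen 10);
`Literature/…/PAdicLFunctionNeZeroHoldsProofs` (`ratTwistedSymbolSum_mul_plusPeriod_holds`),
`…/LeadingTermPPartProofs` (`IsNewformOf.entireLFunction_one_eq`); B. Mazur, J. Tate, J. Teitelbaum, Invent.
Math. 84 (1986) §I.8 (8.6) [MazurTateTeitelbaum1986Invent]; B. J. Birch, Proc. Sympos. Pure Math. 20 (1971)
[Birch1971]; J. E. Cremona, *Algorithms for Modular Elliptic Curves* (1997) §2.8 [CremonaAlgorithms1997];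
HOME/b2b-bsdres-x10b/X6-KURIHARA.md §8.2 (i), §13.
-/

noncomputable section

open Finset

/-! ## Part D — the newform of `E`: the bins in terms of `L(E,1)` and the twisted central values -/

namespace Summit.BirchSwinnertonDyer.Rank1Residual.Supersingular.KuriharaTwist

open scoped MatrixGroups ModularForm
open CongruenceSubgroup Literature.NumberTheory.EllipticCurves Literature.NumberTheory.EllipticCurves.ModularForms

section Units

variable (n : ℕ) [NeZero n]

/-- A Dirichlet character sum over `ℤ/n` is the sum over the units (the character vanishes elsewhere).
[folklore] -/
theorem sum_mulChar_mul_eq_sum_units (χ : DirichletCharacter ℂ n) (g : ZMod n → ℂ) :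
    ∑ a : ZMod n, χ a * g a = ∑ u : (ZMod n)ˣ, χ (u : ZMod n) * g u := by
  classical
  have h : ∑ u : (ZMod n)ˣ, χ (u : ZMod n) * g u =
      ∑ a ∈ (Finset.univ : Finset (ZMod n)ˣ).map ⟨((↑) : (ZMod n)ˣ → ZMod n), Units.val_injective⟩,
        χ a * g a := by
    rw [Finset.sum_map]
    rfl
  rw [h]
  refine (Finset.sum_subset (Finset.subset_univ _) fun a _ ha => ?_).symm
  have hna : ¬ IsUnit a := by
    rintro ⟨u, rfl⟩
    exact ha (Finset.mem_map.2 ⟨u, Finset.mem_univ _, rfl⟩)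
  rw [MulChar.map_nonunit χ hna, zero_mul]

/-- For `k < M` the two spellings of the bin condition agree: `(Σ_ℓ ψ_ℓ(a mod ℓ)).val = k` (the records'
`hbins` / `hball`) iff `m(a) = k` in `ℤ/M`. [folklore] -/
theorem filter_val_eq_filter_binLogHom {M : ℕ} [NeZero M]
    (ψ : (ℓ : ℕ) → (ZMod ℓ)ˣ →* Multiplicative (ZMod M)) {k : ℕ} (hk : k < M) :
    (Finset.univ : Finset (ZMod n)ˣ).filter (fun a =>
        (∑ ℓ ∈ n.primeFactors.attach, Multiplicative.toAdd
          (ψ ℓ.1 (ZMod.unitsMap (Nat.dvd_of_mem_primeFactors ℓ.2) a))).val = k) =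
      (Finset.univ : Finset (ZMod n)ˣ).filter (fun a => Multiplicative.toAdd (binLogHom n ψ a) = (k : ZMod M)) := by
  classical
  refine Finset.filter_congr fun a _ => ?_
  rw [← toAdd_binLogHom_apply]
  constructor
  · intro h
    rw [← h, ZMod.natCast_zmod_val]
  · intro h
    rw [h, ZMod.val_natCast_of_lt hk]

end Units

section Newform

variable {N : ℕ} [NeZero N] {f : CuspForm (Gamma0 N) 2}
  {W : WeierstrassCurve ℚ} [W.IsElliptic] [W.IsGloballyMinimal]

/-- **`S_0`: the trivial-character sum of the plus symbol of the newform of `E`** at a square-free level `n`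
whose primes are good: `Σ_{a ∈ (ℤ/n)ˣ} [a/n]⁺_f = Π_{ℓ ∣ n} (a_ℓ(E) − 2) · [0]⁺_f` (the Hecke relation
`hecke_ratPlusSymbol_of_isNewformOf` iterated: Part A on the prime-factor family of `n`). For Kolyvagin primes
(`a_ℓ ≡ 2 mod p`) this is why `S_0 ≡ 0`; the engine uses it as the ball check `ΣC ∋ S₀`. [folklore] -/
theorem sum_units_ratPlusSymbol_eq_prod_mul (hf : IsNewformOf W f) {n : ℕ} [NeZero n] (hsq : Squarefree n)
    (hgood : ∀ ℓ ∈ n.primeFactors, ∀ [Fact ℓ.Prime], W.HasGoodReductionAtPrime ℓ) :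
    ∑ a : (ZMod n)ˣ, ratPlusSymbol f ((((a : ZMod n).val : ℕ) : ℚ) / (n : ℚ)) =
      (∏ ℓ ∈ n.primeFactors, ((W.frobeniusTrace ℓ : ℚ) - 2)) * ratPlusSymbol f 0 := by
  classical
  haveI hF : ∀ i : ↥n.primeFactors, Fact ((i : ℕ)).Prime := fun i => ⟨Nat.prime_of_mem_primeFactors i.2⟩
  have hn : ∏ i : ↥n.primeFactors, (i : ℕ) = n :=
    (Finset.prod_coe_sort n.primeFactors (fun x : ℕ => x)).trans (Nat.prod_primeFactors_of_squarefree hsq)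
  have h := Identity.sum_units_apply_div_eq_prod_mul (ι := ↥n.primeFactors) (fun i => (i : ℕ))
    Subtype.val_injective (ratPlusSymbol f) (fun r z => ratPlusSymbol_add_intCast_eq f r z)
    (fun i => W.frobeniusTrace i)
    (fun i r => Identity.hecke_ratPlusSymbol_of_isNewformOf hf (hgood i i.2) r) hn
  rw [h, ← Finset.prod_coe_sort n.primeFactors (fun ℓ : ℕ => ((W.frobeniusTrace ℓ : ℚ) - 2))]

/-- **`S_0 · Ω⁺_f = Π_{ℓ ∣ n} (a_ℓ(E) − 2) · L(E, 1)`** in `ℂ` (`[0]⁺_f · Ω⁺_f = L(E,1)`,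
`IsNewformOf.entireLFunction_one_eq`). [folklore] -/
theorem sum_units_ratPlusSymbol_mul_plusPeriod (hf : IsNewformOf W f) {n : ℕ} [NeZero n]
    (hsq : Squarefree n) (hgood : ∀ ℓ ∈ n.primeFactors, ∀ [Fact ℓ.Prime], W.HasGoodReductionAtPrime ℓ) :
    (∑ a : (ZMod n)ˣ, (ratPlusSymbol f ((((a : ZMod n).val : ℕ) : ℚ) / (n : ℚ)) : ℂ)) * (plusPeriod f : ℂ) =
      (∏ ℓ ∈ n.primeFactors, ((W.frobeniusTrace ℓ : ℂ) - 2)) * W.entireLFunction 1 := by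
  rw [← Rat.cast_sum, sum_units_ratPlusSymbol_eq_prod_mul hf hsq hgood, hf.entireLFunction_one_eq]
  push_cast
  ring

omit [W.IsElliptic] [W.IsGloballyMinimal] in
/-- **`S_j · Ω⁺_f = τ(χ_j) · L(f, χ̄_j, 1)` for `j ≠ 0`** — BIRCH'S FORMULA (tree theorem
`ratTwistedSymbolSum_mul_plusPeriod_holds`, Mazur–Tate–Teitelbaum (8.6)) for the even primitive character
`χ_j` (`binChar_even`, `binChar_isPrimitive`: `M` odd, `n` square-free, every `ψ_ℓ` surjective), `L` any entire
continuation of `L(f, χ_j⁻¹, s)`; `τ(χ_j) = Σ_a χ_j(a) e^{2πia/n}` (Mathlib `gaussSum χ_j ZMod.stdAddChar`).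
[cite: MazurTateTeitelbaum1986Invent, §I.8 (8.6)] -/
theorem sum_units_binChar_mul_ratPlusSymbol_mul_plusPeriod (hf : IsNewformOf W f) {M : ℕ} [NeZero M]
    (hM : Odd M) {n : ℕ} [NeZero n] (hsq : Squarefree n)
    (ψ : (ℓ : ℕ) → (ZMod ℓ)ˣ →* Multiplicative (ZMod M))
    (hψ : ∀ ℓ ∈ n.primeFactors, Function.Surjective (ψ ℓ)) {j : ZMod M} (hj : j ≠ 0)
    {L : ℂ → ℂ} (hL : Differentiable ℂ L)
    (hL' : ∀ s : ℂ, 2 < s.re → L s = twistedLSeries f (binChar n ψ j)⁻¹ s) :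
    (∑ a : (ZMod n)ˣ, binChar n ψ j (a : ZMod n) *
        (ratPlusSymbol f ((((a : ZMod n).val : ℕ) : ℚ) / (n : ℚ)) : ℂ)) * (plusPeriod f : ℂ) =
      gaussSum (binChar n ψ j) (ZMod.stdAddChar (N := n)) * L 1 := by
  have h := ratTwistedSymbolSum_mul_plusPeriod_holds hf.1 hf.coeffField_eq_bot
    (binChar_isPrimitive n ψ hsq hψ hj) (binChar_even n ψ hM j) hL hL'
  rw [← h, ratTwistedSymbolSum, sum_mulChar_mul_eq_sum_units]

omit [NeZero N] [W.IsElliptic] [W.IsGloballyMinimal] in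
/-- Bookkeeping: `M·Ω·(M⁻¹·(A + Σ_j e_j g_j)) = A·Ω + Σ_j e_j (g_j Ω)`. [folklore] -/
theorem mul_mul_inv_mul_add_sum_eq {ι : Type*} {M Ω : ℂ} (hM : M ≠ 0) (A : ℂ) (s : Finset ι)
    (e g : ι → ℂ) :
    M * Ω * (M⁻¹ * (A + ∑ j ∈ s, e j * g j)) = A * Ω + ∑ j ∈ s, e j * (g j * Ω) := by
  have h1 : M * Ω * (M⁻¹ * (A + ∑ j ∈ s, e j * g j)) = Ω * (A + ∑ j ∈ s, e j * g j) := by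
    rw [← mul_assoc, mul_comm M Ω, mul_assoc Ω M, mul_inv_cancel₀ hM, mul_one]
  rw [h1, mul_add, Finset.mul_sum, mul_comm Ω A]
  congr 1
  exact Finset.sum_congr rfl fun j _ => by ring

/-- Bookkeeping: if `x·y·q = Z` in `ℂ` with `x ∈ ℕ`, `y ∈ ℝ`, `q ∈ ℚ`, `x·y ≠ 0`, then `q = re Z/(x·y)` in `ℝ`.
[folklore] -/
theorem ratCast_eq_re_div_of_mul_eq {x : ℕ} {y : ℝ} {q : ℚ} {Z : ℂ}
    (h : (x : ℂ) * (y : ℂ) * (q : ℂ) = Z) (hxy : (x : ℝ) * y ≠ 0) : (q : ℝ) = Z.re / (x * y) := by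
  rw [eq_div_iff hxy, ← h]
  have hc : (x : ℂ) * (y : ℂ) * (q : ℂ) = (((q : ℝ) * (x * y) : ℝ) : ℂ) := by
    push_cast
    ring
  rw [hc, Complex.ofReal_re]

/-- **THE BINS OF THE PLUS SYMBOL ARE THE FINITE FOURIER TRANSFORM OF THE TWISTED CENTRAL VALUES**
(implementation 3's formula, X6-KURIHARA.md §8.2 (i), as a tree theorem).  `f` the newform of `E = W`;
`n` square-free with all its primes good for `E`; `M` odd; discrete logarithms `ψ_ℓ : (ℤ/ℓ)ˣ ↠ ℤ/M`, bin
logarithm `m(a) = Σ_ℓ ψ_ℓ(a mod ℓ)`, bin characters `χ_j(a) = e_M(j·m(a))`; `L_j` any entire continuation of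
`L(f, χ_j⁻¹, s)` for `j ≠ 0`.  Then for every `k₀ ∈ ℤ/M`:
`M · Ω⁺_f · Σ_{a : m(a) = k₀} [a/n]⁺_f = Π_{ℓ∣n}(a_ℓ − 2) · L(E,1) + Σ_{j ≠ 0} e_M(−j k₀) · τ(χ_j) · L_j(1)`
— orthogonality (`sum_filter_eq_dft`) + the Hecke relation (`S_0`) + Birch's formula (`S_j`).  Hence the
quantity `c_∞ · Σ_{m(a)=k}[a/n]⁺_f` enclosed by the engine's ball (`hball` of `KuriharaTwistRecordAssemblyBall`)
is an explicit combination of `Ω⁺_f`, `L(E,1)` and the `M − 1` twisted central values.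
[cite: MazurTateTeitelbaum1986Invent, §I.8 (8.6)] -/
theorem plusPeriod_mul_binSum_eq (hf : IsNewformOf W f) {M : ℕ} [NeZero M] (hM : Odd M)
    {n : ℕ} [NeZero n] (hsq : Squarefree n)
    (hgood : ∀ ℓ ∈ n.primeFactors, ∀ [Fact ℓ.Prime], W.HasGoodReductionAtPrime ℓ)
    (ψ : (ℓ : ℕ) → (ZMod ℓ)ˣ →* Multiplicative (ZMod M))
    (hψ : ∀ ℓ ∈ n.primeFactors, Function.Surjective (ψ ℓ)) (k₀ : ZMod M)
    (L : ZMod M → ℂ → ℂ) (hL : ∀ j, j ≠ 0 → Differentiable ℂ (L j))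
    (hL' : ∀ j, j ≠ 0 → ∀ s : ℂ, 2 < s.re → L j s = twistedLSeries f (binChar n ψ j)⁻¹ s) :
    (M : ℂ) * (plusPeriod f : ℂ) *
        ((∑ a ∈ (Finset.univ : Finset (ZMod n)ˣ).filter
            (fun a => Multiplicative.toAdd (binLogHom n ψ a) = k₀),
          ratPlusSymbol f ((((a : ZMod n).val : ℕ) : ℚ) / (n : ℚ)) : ℚ) : ℂ) =
      (∏ ℓ ∈ n.primeFactors, ((W.frobeniusTrace ℓ : ℂ) - 2)) * W.entireLFunction 1 +
        ∑ j ∈ (Finset.univ : Finset (ZMod M)).erase 0, ZMod.stdAddChar (-(j * k₀)) *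
          (gaussSum (binChar n ψ j) (ZMod.stdAddChar (N := n)) * L j 1) := by
  classical
  have hM0 : (M : ℂ) ≠ 0 := by exact_mod_cast NeZero.ne M
  have hS0 : (∑ a : (ZMod n)ˣ, binChar n ψ 0 (a : ZMod n) *
      (ratPlusSymbol f ((((a : ZMod n).val : ℕ) : ℚ) / (n : ℚ)) : ℂ)) * (plusPeriod f : ℂ) =
      (∏ ℓ ∈ n.primeFactors, ((W.frobeniusTrace ℓ : ℂ) - 2)) * W.entireLFunction 1 := by
    simp_rw [binChar_zero_apply_coe, one_mul]
    exact sum_units_ratPlusSymbol_mul_plusPeriod hf hsq hgood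
  have hSj : ∀ j ∈ (Finset.univ : Finset (ZMod M)).erase 0,
      (∑ a : (ZMod n)ˣ, binChar n ψ j (a : ZMod n) *
        (ratPlusSymbol f ((((a : ZMod n).val : ℕ) : ℚ) / (n : ℚ)) : ℂ)) * (plusPeriod f : ℂ) =
      gaussSum (binChar n ψ j) (ZMod.stdAddChar (N := n)) * L j 1 := fun j hj =>
    sum_units_binChar_mul_ratPlusSymbol_mul_plusPeriod hf hM hsq ψ hψ (Finset.mem_erase.1 hj).1
      (hL j (Finset.mem_erase.1 hj).1) (hL' j (Finset.mem_erase.1 hj).1)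
  rw [Rat.cast_sum, sum_filter_eq_dft n ψ _ k₀, ← Finset.add_sum_erase _ _ (Finset.mem_univ (0 : ZMod M)),
    zero_mul, neg_zero, AddChar.map_zero_eq_one, one_mul, ← hS0,
    ← Finset.sum_congr rfl fun j hj => congrArg (fun z => ZMod.stdAddChar (-(j * k₀)) * z) (hSj j hj)]
  exact mul_mul_inv_mul_add_sum_eq hM0 _ _ _ _

/-- **Real form**: with `Z_{k₀}` the right-hand side of `plusPeriod_mul_binSum_eq`,
`Σ_{a : m(a) = k₀} [a/n]⁺_f = re(Z_{k₀}) / (M · Ω⁺_f)` as real numbers (`Ω⁺_f > 0`). [folklore] -/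
theorem ratCast_binSum_eq_re_div (hf : IsNewformOf W f) {M : ℕ} [NeZero M] (hM : Odd M)
    {n : ℕ} [NeZero n] (hsq : Squarefree n)
    (hgood : ∀ ℓ ∈ n.primeFactors, ∀ [Fact ℓ.Prime], W.HasGoodReductionAtPrime ℓ)
    (ψ : (ℓ : ℕ) → (ZMod ℓ)ˣ →* Multiplicative (ZMod M))
    (hψ : ∀ ℓ ∈ n.primeFactors, Function.Surjective (ψ ℓ)) (k₀ : ZMod M)
    (L : ZMod M → ℂ → ℂ) (hL : ∀ j, j ≠ 0 → Differentiable ℂ (L j))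
    (hL' : ∀ j, j ≠ 0 → ∀ s : ℂ, 2 < s.re → L j s = twistedLSeries f (binChar n ψ j)⁻¹ s) :
    ((∑ a ∈ (Finset.univ : Finset (ZMod n)ˣ).filter
          (fun a => Multiplicative.toAdd (binLogHom n ψ a) = k₀),
        ratPlusSymbol f ((((a : ZMod n).val : ℕ) : ℚ) / (n : ℚ)) : ℚ) : ℝ) =
      ((∏ ℓ ∈ n.primeFactors, ((W.frobeniusTrace ℓ : ℂ) - 2)) * W.entireLFunction 1 +
        ∑ j ∈ (Finset.univ : Finset (ZMod M)).erase 0, ZMod.stdAddChar (-(j * k₀)) *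
          (gaussSum (binChar n ψ j) (ZMod.stdAddChar (N := n)) * L j 1)).re / (M * plusPeriod f) := by
  have hΩ : 0 < plusPeriod f := IsNewform0.plusPeriod_pos_holds hf.1 hf.coeffField_eq_bot
  exact ratCast_eq_re_div_of_mul_eq (plusPeriod_mul_binSum_eq hf hM hsq hgood ψ hψ k₀ L hL hL')
    (mul_ne_zero (by exact_mod_cast NeZero.ne M) hΩ.ne')

end Newform

end Summit.BirchSwinnertonDyer.Rank1Residual.Supersingular.KuriharaTwist

end
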